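import Summits.Parity.GeneralizedHardyLittlewood.Theorems.PrimeLevelFamEdgeMomentsBeyondDiagonalDiagRemInner
import Summits.Parity.GeneralizedHardyLittlewood.Theorems.PrimeLevelFamEdgeMomentsBeyondDiagonalDiagDecorOrderOneOneAssembly
import HarnessLib

/-!
# Route `PrimeLevelFamEdge`, crux K_A `MomentsBeyondDiagonal` (stmt-Parity-20007), line «petersson_layers» v4, stub `stub_diag`:
# **THE REMAINDER ESTIMATE (R) OF ORDER `(1,1)` — and hence the order-`(1,1)` target of `stub_diag`, UNCONDITIONALLY**

Assembly of the four bricks `…DiagRemAbelTwoSeq`, `…DiagRemBoseTwoSeq`, `…DiagRemMonomials`, `…DiagRemInner`: the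
hypothesis (R) of `…DiagDecorOrderOneOneAssembly.orderOneOne_target_of_remainder` (p826053) on the window `(1, 3/2]`.
For each pair of Selberg coordinates `(c,g)` the inner `(k₁,k₂)` sum is `W(cg)²` times the sum bounded in
`…DiagRemInner.abs_inner_rem_le`; the threshold is `K₁ = ⌊q̂^{1/4}⌋` when `2αK₁Y ≤ 1` (rows `k₁ ≤ K₁` save `√(2αK₁Y)`,
rows `k₁ > K₁` save `(1+log K₁)⁻¹²`) and `K₁ = 0` otherwise (then `1/g < 2K₁M/(cq̂²)` is itself a power saving); the
`Σ_cΣ_g` bookkeeping is K_B's `…Corner.sum_sum_divWeight_div_mul_le` / `…_sq_le`.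

* `prefactor_aux`, `selbergRem_inner_eq` — the (R) summand in the coordinates of `…DiagRemInner` (`τ(k)x′_{nk}/(nk) = W(n)a_n(k)P(ℓ⁺/log M)`);
* `per_term_bound` — one `(c,g)` term, both threshold regimes;
* `final_arith` — the closing arithmetic;
* `remainder_estimate` — **(R): `|Sel_rem(q)| ≤ C/log q̂` for `q ≥ q₀`, every admissible `P`, every `Δ' ∈ (1, 3/2]`;**
* `orderOneOne_target` — **the order-`(1,1)` target of `…DiagOrderSelberg.subDiag_of_selbergOrderAsymptotics`
  (`i = j = 1`, `τ₁₁ = Δ′²K₀/(2(π²/6)²)`), now unconditional.**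

Def-free; theorems only. Helper `--supports stmt-Parity-20007`; closes nothing (the other orders `(i,j)`, `i+j` even,
`max(i,j) ≥ 2`, of `stub_diag` remain, as do `stub_rung/core/band/identP`); K_A, K_B and the Parity summit are NOT proved;
nothing about Landau–Siegel zeros.

## References
* E. Kowalski, P. Michel, J. VanderKam, J. reine angew. Math. 526 (2000), (22)–(28) pp. 12–15 and Prop. 5.1 p. 18.
  [cite: KowalskiMichelVanderKam2000, (23)–(28) and Prop. 5.1 — derivation (order-(1,1) piece of the diagonal, general Q)]
-/

noncomputable section

open scoped Real ArithmeticFunction.Moebius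
open Finset ArithmeticFunction Polynomial Real MeasureTheory

namespace Summit.Parity.GeneralizedHardyLittlewood.Theorems.MomentsBeyondDiagonal.DiagCorner

open Literature.NumberTheory.LFunctions Literature.NumberTheory.LFunctions.KMV2000
open MollifierMainTerm (W)
open Literature.Barriers.Parity (Icc_one_eq_Ioc_zero)
open Summit.Parity.GeneralizedHardyLittlewood.Theorems.BeyondDiagonalBeatsQuarter.KernelFormXSq
  (copTauW copTauW_apply divWeight divWeight_nonneg one_le_divWeight abs_W_le)
open Summit.Parity.GeneralizedHardyLittlewood.Theorems.BeyondDiagonalBeatsQuarter.Corner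
open Summit.Parity.GeneralizedHardyLittlewood.Theorems.MomentsBeyondDiagonal.DiagKernel
  (orderOneOne_target_of_remainder coeff_zero_one_of_admissible)

/-! ### The (R) summand in the coordinates of `…DiagRemInner` -/

/-- `y₁y₂(τ₁τ₂w) = W²(A₁A₂w)` from `τᵢyᵢ = W·Aᵢ`. [folklore] -/
theorem prefactor_aux {y₁ y₂ τ₁ τ₂ w Wn A₁ A₂ : ℝ} (h₁ : τ₁ * y₁ = Wn * A₁) (h₂ : τ₂ * y₂ = Wn * A₂) :
    y₁ * y₂ * (τ₁ * τ₂ * w) = Wn ^ 2 * (A₁ * A₂ * w) := by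
  have : y₁ * y₂ * (τ₁ * τ₂ * w) = (τ₁ * y₁) * (τ₂ * y₂) * w := by ring
  rw [this, h₁, h₂]; ring

/-- **The inner `(k₁,k₂)` sum of (R) for fixed `(c,g)` is `W(cg)²` times the sum of `…DiagRemInner.abs_inner_rem_le`**
(`τ(k)x′_{nk}/(nk) = W(n)a_n(k)P(ℓ⁺(k)/log M)`, `q̂²/(g²k₁k₂) = 1/(αk₁k₂)`, `α = g²/q̂²`).
[cite: KowalskiMichelVanderKam2000, (23) — derivation] -/
theorem selbergRem_inner_eq (P : ℝ[X]) {M Q : ℝ} (hM : 0 < M) (hQ : 0 < Q) {c g : ℕ} (hc : c ≠ 0) (hg : g ≠ 0)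
    (E₀₀ E₀₁ E₁₀ E₁₁ μ₂ : ℝ) :
    ∑ k₁ ∈ Icc 1 (⌊M⌋₊ / (c * g)), ∑ k₂ ∈ Icc 1 (⌊M⌋₊ / (c * g)),
      ((μ (c * g * k₁) : ℝ) * ((psi (c * g * k₁))⁻¹ *
          P.eval (Real.log (M / ((c * g * k₁ : ℕ) : ℝ)) / Real.log M))) / ((c * g * k₁ : ℕ) : ℝ) *
        (((μ (c * g * k₂) : ℝ) * ((psi (c * g * k₂))⁻¹ *
          P.eval (Real.log (M / ((c * g * k₂ : ℕ) : ℝ)) / Real.log M))) / ((c * g * k₂ : ℕ) : ℝ)) *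
        ((k₁.divisors.card : ℝ) * (k₂.divisors.card : ℝ) *
          (((2 * (Real.log Q - Real.log g) - Real.log k₁ - Real.log k₂) ^ 2 / 4 -
              ((∑ p ∈ k₁.primeFactors, Real.log p ^ 2) + ∑ p ∈ k₂.primeFactors, Real.log p ^ 2) / 4) *
            ((∫ u₁ in Set.Ioi (0 : ℝ), ∫ u₂ in Set.Ioi ((((g * g * (k₁ * k₂) : ℕ) : ℝ) / Q ^ 2) / u₁),
                Real.exp (-(u₁ + u₂)) / (1 - Real.exp (-(u₁ + u₂))) ^ 2) -
              (Real.log (Q ^ 2 / ((g * g * (k₁ * k₂) : ℕ) : ℝ)) / 2 + E₀₀)) +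
          (2 * (Real.log Q - Real.log g) - Real.log k₁ - Real.log k₂) / 2 *
            (((∫ u₁ in Set.Ioi (0 : ℝ), ∫ u₂ in Set.Ioi ((((g * g * (k₁ * k₂) : ℕ) : ℝ) / Q ^ 2) / u₁),
                  Real.exp (-(u₁ + u₂)) / (1 - Real.exp (-(u₁ + u₂))) ^ 2 * Real.log u₂) -
                (-(Real.log (Q ^ 2 / ((g * g * (k₁ * k₂) : ℕ) : ℝ)) ^ 2) / 8 + E₀₁)) +
              ((∫ u₁ in Set.Ioi (0 : ℝ), Real.log u₁ *
                  ∫ u₂ in Set.Ioi ((((g * g * (k₁ * k₂) : ℕ) : ℝ) / Q ^ 2) / u₁),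
                    Real.exp (-(u₁ + u₂)) / (1 - Real.exp (-(u₁ + u₂))) ^ 2) -
                (-(Real.log (Q ^ 2 / ((g * g * (k₁ * k₂) : ℕ) : ℝ)) ^ 2) / 8 + E₁₀))) +
          ((∫ u₁ in Set.Ioi (0 : ℝ), Real.log u₁ *
              ∫ u₂ in Set.Ioi ((((g * g * (k₁ * k₂) : ℕ) : ℝ) / Q ^ 2) / u₁),
                Real.exp (-(u₁ + u₂)) / (1 - Real.exp (-(u₁ + u₂))) ^ 2 * Real.log u₂) -
            (Real.log (Q ^ 2 / ((g * g * (k₁ * k₂) : ℕ) : ℝ)) ^ 3 / 24 -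
              2 * μ₂ * Real.log (Q ^ 2 / ((g * g * (k₁ * k₂) : ℕ) : ℝ)) + E₁₁)))) =
    W (c * g) ^ 2 * ∑ k₁ ∈ Icc 1 ⌊M / ((c * g : ℕ) : ℝ)⌋₊, ∑ k₂ ∈ Icc 1 ⌊M / ((c * g : ℕ) : ℝ)⌋₊,
      copTauW (c * g) k₁ * P.eval (ellp (M / ((c * g : ℕ) : ℝ)) k₁ / Real.log M) *
          (copTauW (c * g) k₂ * P.eval (ellp (M / ((c * g : ℕ) : ℝ)) k₂ / Real.log M)) *
        (((2 * (Real.log Q - Real.log g) - Real.log k₁ - Real.log k₂) ^ 2 / 4 -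
            ((∑ p ∈ k₁.primeFactors, Real.log p ^ 2) + ∑ p ∈ k₂.primeFactors, Real.log p ^ 2) / 4) *
          ((∫ u₁ in Set.Ioi (0 : ℝ), ∫ u₂ in Set.Ioi (((g : ℝ) ^ 2 / Q ^ 2 * k₁ * k₂) / u₁),
              Real.exp (-(u₁ + u₂)) / (1 - Real.exp (-(u₁ + u₂))) ^ 2) -
            (Real.log (1 / ((g : ℝ) ^ 2 / Q ^ 2 * k₁ * k₂)) / 2 + E₀₀)) +
        (2 * (Real.log Q - Real.log g) - Real.log k₁ - Real.log k₂) / 2 *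
          (((∫ u₁ in Set.Ioi (0 : ℝ), ∫ u₂ in Set.Ioi (((g : ℝ) ^ 2 / Q ^ 2 * k₁ * k₂) / u₁),
              Real.exp (-(u₁ + u₂)) / (1 - Real.exp (-(u₁ + u₂))) ^ 2 * Real.log u₂) -
            (-(Real.log (1 / ((g : ℝ) ^ 2 / Q ^ 2 * k₁ * k₂)) ^ 2) / 8 + E₀₁)) +
          ((∫ u₁ in Set.Ioi (0 : ℝ), Real.log u₁ * ∫ u₂ in Set.Ioi (((g : ℝ) ^ 2 / Q ^ 2 * k₁ * k₂) / u₁),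
              Real.exp (-(u₁ + u₂)) / (1 - Real.exp (-(u₁ + u₂))) ^ 2) -
            (-(Real.log (1 / ((g : ℝ) ^ 2 / Q ^ 2 * k₁ * k₂)) ^ 2) / 8 + E₁₀))) +
        ((∫ u₁ in Set.Ioi (0 : ℝ), Real.log u₁ * ∫ u₂ in Set.Ioi (((g : ℝ) ^ 2 / Q ^ 2 * k₁ * k₂) / u₁),
            Real.exp (-(u₁ + u₂)) / (1 - Real.exp (-(u₁ + u₂))) ^ 2 * Real.log u₂) -
          (Real.log (1 / ((g : ℝ) ^ 2 / Q ^ 2 * k₁ * k₂)) ^ 3 / 24 -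
            2 * μ₂ * Real.log (1 / ((g : ℝ) ^ 2 / Q ^ 2 * k₁ * k₂)) + E₁₁))) := by
  have hn : c * g ≠ 0 := mul_ne_zero hc hg
  have hY0 : 0 ≤ M / ((c * g : ℕ) : ℝ) := by positivity
  have hg0 : (0 : ℝ) < g := by exact_mod_cast Nat.pos_of_ne_zero hg
  rw [Nat.floor_div_natCast, Finset.mul_sum]
  refine Finset.sum_congr rfl fun k₁ hk₁ ↦ ?_
  rw [Finset.mul_sum]
  refine Finset.sum_congr rfl fun k₂ hk₂ ↦ ?_
  have hk₁0 : k₁ ≠ 0 := by have := (Finset.mem_Icc.1 hk₁).1; omega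
  have hk₂0 : k₂ ≠ 0 := by have := (Finset.mem_Icc.1 hk₂).1; omega
  have hk₁' : k₁ ∈ Icc 1 ⌊M / ((c * g : ℕ) : ℝ)⌋₊ := by rwa [Nat.floor_div_natCast]
  have hk₂' : k₂ ∈ Icc 1 ⌊M / ((c * g : ℕ) : ℝ)⌋₊ := by rwa [Nat.floor_div_natCast]
  have hk₁r : (0 : ℝ) < k₁ := by exact_mod_cast Nat.pos_of_ne_zero hk₁0
  have hk₂r : (0 : ℝ) < k₂ := by exact_mod_cast Nat.pos_of_ne_zero hk₂0
  rw [ellp_eq_log hY0 hk₁', ellp_eq_log hY0 hk₂']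
  have hy : (((g * g * (k₁ * k₂) : ℕ) : ℝ) / Q ^ 2) = (g : ℝ) ^ 2 / Q ^ 2 * k₁ * k₂ := by
    push_cast; ring
  have hlg : Real.log (Q ^ 2 / ((g * g * (k₁ * k₂) : ℕ) : ℝ)) = Real.log (1 / ((g : ℝ) ^ 2 / Q ^ 2 * k₁ * k₂)) := by
    congr 1
    push_cast
    field_simp
  simp only [hy, hlg]
  exact prefactor_aux (tau_mul_xP_div P M hn hk₁0) (tau_mul_xP_div P M hn hk₂0)

/-! ### One `(c,g)` term -/

set_option maxHeartbeats 400000 in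
/-- **One `(c,g)` term of (R), both threshold regimes.** If `|F(n,g)| ≤ C·D(n)·(Λ¹⁰√(2(g²/Q²)K(M/n)) + Λ¹⁰/(1+log K)¹²)`
for every threshold `K` with `2(g²/Q²)K(M/n) ≤ 1` (`n, g ≥ 1`, `n, g ≤ M`), then for `c ≤ ⌊M⌋`, `g ≤ ⌊M⌋/c` and ANY `K₁`:
`|μ(g)·c·(W(cg)²·F(cg,g))| ≤ CΛ¹⁰·(D(cg)/(cg)·(√(2K₁M)/Q + 2K₁M/Q²) + D(cg)/(cg²)·(1+log K₁)⁻¹²)`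
(threshold `K₁` if admissible, else `0`, where `1/g < 2K₁M/(cQ²)`).
[cite: KowalskiMichelVanderKam2000, Prop. 5.1 — derivation (corner bookkeeping)] -/
theorem per_term_bound {F : ℕ → ℕ → ℝ} {C Lam Q M : ℝ} (hC : 0 ≤ C) (hLam : 0 ≤ Lam) (hQ : 0 < Q) (hM : 1 ≤ M)
    (hF : ∀ n g : ℕ, n ≠ 0 → g ≠ 0 → (n : ℝ) ≤ M → (g : ℝ) ≤ M → ∀ K : ℕ,
      2 * ((g : ℝ) ^ 2 / Q ^ 2) * K * (M / n) ≤ 1 →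
      |F n g| ≤ C * divWeight n *
        (Lam ^ 10 * Real.sqrt (2 * ((g : ℝ) ^ 2 / Q ^ 2) * K * (M / n)) + Lam ^ 10 / (1 + Real.log K) ^ 12))
    (K₁ : ℕ) {c g : ℕ} (hc : c ∈ Icc 1 ⌊M⌋₊) (hg : g ∈ Icc 1 (⌊M⌋₊ / c)) :
    |(μ g : ℝ) * c * (W (c * g) ^ 2 * F (c * g) g)| ≤
      C * Lam ^ 10 * (divWeight (c * g) / ((c : ℝ) * g) * (Real.sqrt (2 * K₁ * M) / Q + 2 * K₁ * M / Q ^ 2) +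
        divWeight (c * g) / ((c : ℝ) * g ^ 2) * (1 / (1 + Real.log K₁) ^ 12)) := by
  rw [show (μ g : ℝ) * c * (W (c * g) ^ 2 * F (c * g) g) = (μ g : ℝ) * c * W (c * g) ^ 2 * F (c * g) g by ring]
  have hM0 : 0 < M := by linarith
  set N : ℕ := ⌊M⌋₊ with hNdef
  have hNM : (N : ℝ) ≤ M := Nat.floor_le hM0.le
  have hc1 := (Finset.mem_Icc.1 hc).1
  have hg1 := (Finset.mem_Icc.1 hg).1
  have hc0 : (0 : ℝ) < c := by exact_mod_cast hc1
  have hgr : (0 : ℝ) < g := by exact_mod_cast hg1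
  have hc1r : (1 : ℝ) ≤ c := by exact_mod_cast hc1
  have hg1r : (1 : ℝ) ≤ g := by exact_mod_cast hg1
  have hcg0 : c * g ≠ 0 := by positivity
  have hnN : c * g ≤ N := by
    have := (Finset.mem_Icc.1 hg).2
    calc c * g ≤ c * (N / c) := Nat.mul_le_mul_left c this
      _ ≤ N := Nat.mul_div_le N c
  have hnM : ((c * g : ℕ) : ℝ) ≤ M := le_trans (by exact_mod_cast hnN) hNM
  have hgN : g ≤ N := (Finset.mem_Icc.1 hg).2.trans (Nat.div_le_self N c)
  have hgM : (g : ℝ) ≤ M := le_trans (by exact_mod_cast hgN) hNM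
  have hD := divWeight_nonneg (c * g)
  have hK0 : (0 : ℝ) ≤ K₁ := Nat.cast_nonneg _
  have hlogK : 0 ≤ Real.log (K₁ : ℝ) := Real.log_natCast_nonneg K₁
  have hLam10 : 0 ≤ Lam ^ 10 := pow_nonneg hLam 10
  -- the atoms `u = 1/(cg)`, `v = 1/(cg²)`, `S₁ = √(2K₁M)/Q`, `L₁ = 2K₁M/Q²`, `T = (1+log K₁)⁻¹²`
  set u : ℝ := 1 / ((c : ℝ) * g) with hu
  set v : ℝ := 1 / ((c : ℝ) * g ^ 2) with hv
  set S₁ : ℝ := Real.sqrt (2 * K₁ * M) / Q with hS₁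
  set L₁ : ℝ := 2 * K₁ * M / Q ^ 2 with hL₁
  set T : ℝ := 1 / (1 + Real.log (K₁ : ℝ)) ^ 12 with hT
  have hu0 : 0 ≤ u := by positivity
  have hv0 : 0 ≤ v := by positivity
  have hS0 : 0 ≤ S₁ := by positivity
  have hL0 : 0 ≤ L₁ := by positivity
  have hT0 : 0 ≤ T := by positivity
  have huv : v * g = u := by rw [hu, hv]; field_simp
  have hvu : v ≤ u := by
    rw [← huv]
    have : v * 1 ≤ v * g := mul_le_mul_of_nonneg_left hg1r hv0
    linarith
  rw [div_eq_mul_one_div (divWeight (c * g)) ((c : ℝ) * g), div_eq_mul_one_div (divWeight (c * g)) ((c : ℝ) * g ^ 2)]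
  -- |μ g · c · W(n)²| ≤ v
  have hW : W (c * g) ^ 2 ≤ (((c * g : ℕ) : ℝ))⁻¹ ^ 2 := by
    rw [← sq_abs]; exact pow_le_pow_left₀ (abs_nonneg _) (abs_W_le (c * g)) 2
  have hμ : |(μ g : ℝ)| ≤ 1 := by exact_mod_cast ArithmeticFunction.abs_moebius_le_one
  have hcoef : |(μ g : ℝ) * c * W (c * g) ^ 2| ≤ v := by
    rw [abs_mul, abs_mul, abs_of_pos hc0, abs_of_nonneg (sq_nonneg (W (c * g)))]
    calc |(μ g : ℝ)| * c * W (c * g) ^ 2 ≤ 1 * c * (((c * g : ℕ) : ℝ))⁻¹ ^ 2 := by gcongr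
      _ = v := by rw [hv]; push_cast; field_simp
  rw [abs_mul]
  by_cases hA : 2 * ((g : ℝ) ^ 2 / Q ^ 2) * K₁ * (M / ((c * g : ℕ) : ℝ)) ≤ 1
  · -- regime A: threshold K₁
    have h := hF (c * g) g hcg0 (by omega) hnM hgM K₁ hA
    have hsqrt : Real.sqrt (2 * ((g : ℝ) ^ 2 / Q ^ 2) * K₁ * (M / ((c * g : ℕ) : ℝ))) ≤ g * S₁ := by
      have h1 : 2 * ((g : ℝ) ^ 2 / Q ^ 2) * K₁ * (M / ((c * g : ℕ) : ℝ)) ≤ (g * S₁) ^ 2 := by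
        rw [hS₁, mul_pow, div_pow, Real.sq_sqrt (by positivity)]
        have e : 2 * ((g : ℝ) ^ 2 / Q ^ 2) * K₁ * (M / ((c * g : ℕ) : ℝ)) =
            (g : ℝ) ^ 2 * (2 * K₁ * M / Q ^ 2) * u := by
          rw [hu]; push_cast; field_simp
        rw [e]
        have hu1 : u ≤ 1 := by
          rw [hu, div_le_one (by positivity)]; nlinarith
        have : 0 ≤ (g : ℝ) ^ 2 * (2 * K₁ * M / Q ^ 2) := by positivity
        nlinarith
      calc _ ≤ Real.sqrt ((g * S₁) ^ 2) := Real.sqrt_le_sqrt h1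
        _ = g * S₁ := Real.sqrt_sq (by positivity)
    have h' : |F (c * g) g| ≤ C * divWeight (c * g) * (Lam ^ 10 * (g * S₁ + T)) := by
      refine h.trans (mul_le_mul_of_nonneg_left ?_ (by positivity))
      rw [div_eq_mul_one_div (Lam ^ 10)]
      calc Lam ^ 10 * Real.sqrt (2 * ((g : ℝ) ^ 2 / Q ^ 2) * K₁ * (M / ((c * g : ℕ) : ℝ))) + Lam ^ 10 * T
          ≤ Lam ^ 10 * (g * S₁) + Lam ^ 10 * T := by gcongr
        _ = Lam ^ 10 * (g * S₁ + T) := by ring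
    calc |(μ g : ℝ) * c * W (c * g) ^ 2| * |F (c * g) g|
        ≤ v * (C * divWeight (c * g) * (Lam ^ 10 * (g * S₁ + T))) := mul_le_mul hcoef h' (abs_nonneg _) hv0
      _ = C * Lam ^ 10 * (divWeight (c * g) * (v * g) * S₁ + divWeight (c * g) * v * T) := by ring
      _ = C * Lam ^ 10 * (divWeight (c * g) * u * S₁ + divWeight (c * g) * v * T) := by rw [huv]
      _ ≤ C * Lam ^ 10 * (divWeight (c * g) * u * (S₁ + L₁) + divWeight (c * g) * v * T) := by
          gcongr
          exact le_add_of_nonneg_right hL0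
  · -- regime B: threshold 0; `1/g < 2K₁M/(cQ²) ≤ 2K₁M/Q²`
    rw [not_le] at hA
    have h := hF (c * g) g hcg0 (by omega) hnM hgM 0 (by simp)
    simp only [Nat.cast_zero, mul_zero, zero_mul, Real.sqrt_zero, Real.log_zero, add_zero, one_pow, div_one,
      zero_add] at h
    -- `v ≤ u · L₁`
    have hA' : 1 < L₁ * ((g : ℝ) / c) := by
      have e : 2 * ((g : ℝ) ^ 2 / Q ^ 2) * K₁ * (M / ((c * g : ℕ) : ℝ)) = L₁ * ((g : ℝ) / c) := by
        rw [hL₁]; push_cast; field_simp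
      exact lt_of_lt_of_eq hA e
    have hgc : (g : ℝ) / c ≤ g := div_le_self hgr.le hc1r
    have h1 : 1 ≤ L₁ * g := by
      have := mul_le_mul_of_nonneg_left hgc hL0
      linarith
    have hginv : v ≤ u * L₁ := by
      rw [← huv]
      have : v * 1 ≤ v * (L₁ * g) := mul_le_mul_of_nonneg_left h1 hv0
      linarith
    calc |(μ g : ℝ) * c * W (c * g) ^ 2| * |F (c * g) g|
        ≤ v * (C * divWeight (c * g) * Lam ^ 10) := mul_le_mul hcoef h (abs_nonneg _) hv0
      _ = C * Lam ^ 10 * divWeight (c * g) * v := by ring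
      _ ≤ C * Lam ^ 10 * divWeight (c * g) * (u * L₁) := mul_le_mul_of_nonneg_left hginv (by positivity)
      _ ≤ C * Lam ^ 10 * (divWeight (c * g) * u * (S₁ + L₁) + divWeight (c * g) * v * T) := by
          have e : C * Lam ^ 10 * divWeight (c * g) * (u * L₁) = C * Lam ^ 10 * (divWeight (c * g) * u * L₁) := by ring
          rw [e]
          apply mul_le_mul_of_nonneg_left _ (by positivity)
          linarith [mul_nonneg (mul_nonneg hD hu0) hS0, mul_nonneg (mul_nonneg hD hv0) hT0]

/-! ### The closing arithmetic -/

/-- The closing arithmetic of (R): `CΛ¹⁰((1+l)⁴A₁ + Z(2+l)A₂) ≤ C(5¹⁴·4C₈ + 2·5¹¹4¹²Z)/L` from `A₁ ≤ 4C₈/(1+L)¹⁵`,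
`A₂ ≤ 4¹²/L¹²`, `1 + l ≤ Λ ≤ 5L`, `L ≥ 1`. [folklore] -/
theorem final_arith {C C₈ Z L Lam l A₁ A₂ : ℝ} (hC : 0 ≤ C) (hC₈ : 0 ≤ C₈) (hZ : 0 ≤ Z) (hL : 1 ≤ L) (hLam1 : 1 ≤ Lam)
    (hLam : Lam ≤ 5 * L) (hl : 0 ≤ l) (hlLam : 1 + l ≤ Lam) (hA₁0 : 0 ≤ A₁) (hA₁ : A₁ ≤ 4 * C₈ / (1 + L) ^ 15)
    (hA₂0 : 0 ≤ A₂) (hA₂ : A₂ ≤ 4 ^ 12 / L ^ 12) :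
    C * Lam ^ 10 * ((1 + l) ^ 4 * A₁ + Z * (2 + l) * A₂) ≤ C * (5 ^ 14 * 4 * C₈ + 2 * 5 ^ 11 * 4 ^ 12 * Z) / L := by
  have hL0 : 0 < L := by linarith
  have hLam0 : 0 ≤ Lam := by linarith
  -- first piece: Λ¹⁰(1+l)⁴A₁ ≤ Λ¹⁴·4C₈/(1+L)¹⁵ ≤ (5L)¹⁴·4C₈/L¹⁵ = 5¹⁴·4C₈/L
  have h14 : (1 + l) ^ 4 ≤ Lam ^ 4 := pow_le_pow_left₀ (by linarith) hlLam 4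
  have hΛ14 : Lam ^ 14 ≤ (5 * L) ^ 14 := pow_le_pow_left₀ hLam0 hLam 14
  have hΛ11 : Lam ^ 11 ≤ (5 * L) ^ 11 := pow_le_pow_left₀ hLam0 hLam 11
  have h1L : L ^ 15 ≤ (1 + L) ^ 15 := pow_le_pow_left₀ hL0.le (by linarith) 15
  have p1 : Lam ^ 10 * ((1 + l) ^ 4 * A₁) ≤ 5 ^ 14 * 4 * C₈ / L := by
    calc Lam ^ 10 * ((1 + l) ^ 4 * A₁) ≤ Lam ^ 10 * (Lam ^ 4 * (4 * C₈ / (1 + L) ^ 15)) := by gcongr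
      _ = Lam ^ 14 * (4 * C₈) / (1 + L) ^ 15 := by ring
      _ ≤ (5 * L) ^ 14 * (4 * C₈) / L ^ 15 := by
          gcongr
      _ = 5 ^ 14 * 4 * C₈ / L := by field_simp
  -- second piece: Λ¹⁰·Z(2+l)A₂ ≤ 2ZΛ¹¹·4¹²/L¹² ≤ 2·5¹¹4¹²Z/L
  have h2l : 2 + l ≤ 2 * Lam := by linarith
  have p2 : Lam ^ 10 * (Z * (2 + l) * A₂) ≤ 2 * 5 ^ 11 * 4 ^ 12 * Z / L := by
    calc Lam ^ 10 * (Z * (2 + l) * A₂) ≤ Lam ^ 10 * (Z * (2 * Lam) * (4 ^ 12 / L ^ 12)) := by gcongr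
      _ = 2 * Z * 4 ^ 12 * Lam ^ 11 / L ^ 12 := by ring
      _ ≤ 2 * Z * 4 ^ 12 * (5 * L) ^ 11 / L ^ 12 := by gcongr
      _ = 2 * 5 ^ 11 * 4 ^ 12 * Z / L := by field_simp
  calc C * Lam ^ 10 * ((1 + l) ^ 4 * A₁ + Z * (2 + l) * A₂)
      = C * (Lam ^ 10 * ((1 + l) ^ 4 * A₁) + Lam ^ 10 * (Z * (2 + l) * A₂)) := by ring
    _ ≤ C * (5 ^ 14 * 4 * C₈ / L + 2 * 5 ^ 11 * 4 ^ 12 * Z / L) := by gcongr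
    _ = C * (5 ^ 14 * 4 * C₈ + 2 * 5 ^ 11 * 4 ^ 12 * Z) / L := by field_simp

end Summit.Parity.GeneralizedHardyLittlewood.Theorems.MomentsBeyondDiagonal.DiagCorner

end
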